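import Summits.HodgeConjecture.HodgeConjecture.Theorems.Ring2WeilCoverageCMFieldAllPrimesH
import HarnessLib

/-!
# Weil-type components over quartic CM fields, IX (part P): integer-coordinate arithmetic of
# `ℤ[σ] = ℤ[√2]`, `σ = -3-√2` (`σ² = -6σ - 7`) — the toolkit for the split side of the `D₄` table

research route conditional on HC_CM; not a corollary; Q11.4-sentence-2 already refuted in dim ≥ 3. Cell
`pub-hodge-ring2`, seat `ring2-b03` (gen 53); `HOME/WEIL-FAMILY-COVERAGE.md` §b03.5, seventh table
(`E = ℚ(√-(3+√2))`, `F = ℚ(√2)`, `R = S² + 6S + 7`). Parts C/H/O decide the NON-split side of that table for every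
prime; the split side (`[ℓ] = [1]` for the primes of the three split types of part O) needs norm witnesses for a
VARIABLE prime in a non-Galois field, where the `z·τz` device of parts I–L (cyclic fields) is unavailable. The
replacement (parts P–S) is a descent INSIDE `F`: norms `x² - σy²` of integral elements of `E = F(√σ)` are peeled
prime by prime in `ℤ[σ]`, which is `ℤ[√2]` (`√2 = -σ - 3`). This file is the elementary toolkit, everything in
integer coordinates `(a, b) ↔ a + bσ` — product `(ac - 7bd, ad + bc - 6bd)`, norm `N(a,b) = a² - 6ab + 7b² =
(a - 3b)² - 2b²`, conjugate `(a - 6b, -b)` — with no model of `F` needed: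

* §1 norm multiplicativity, cancellation, and the divisibility criteria at the three special primes:
  `σ ∣ (a,b) ⟺ 7 ∣ a` (the tame ramified place `(σ)`, norm `7`), `(6+σ) ∣ (a,b) ⟺ 7 ∣ a + b` (its conjugate
  `(3-√2)`), `(3+σ) = (-√2) ∣ (a,b) ⟺ 2 ∣ a + b ⟺ 2 ∣ N(a,b)` (the dyadic place), `7 ∣ N ⟹ σ ∣ · ∨ (6+σ) ∣ ·`,
  and `q ∣ N(a,b) ⟹ q ∣ a ∧ q ∣ b` for a prime `q` with `2` a non-square (`q ≡ ±3 (mod 8)`, inert in `F`);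
* §2 a principal DEGREE-ONE prime `π = (u, v)` of norm `ℓ` with Bezout data `γ = (g₀, g₁)`, `t` (`πγ = t + σ`, as
  in the gen-50 engine `Ring2WeilCoverageCMFieldDegreeOnePrimesGeneral`): the divisibility criterion
  `π ∣ (a,b) ⟺ ℓ ∣ a - tb`, multiplicativity of the evaluation `(a,b) ↦ a - tb (mod ℓ)`, and EUCLID'S LEMMA for `π`;
* §3 TOTAL POSITIVITY `0 < a - 3b ∧ 0 < N(a,b)` (both real embeddings positive): closed under products, and
  cancellable;
* §4 PELL: a totally positive unit is a square (`m² - 2n² = 1`, `m > 0` ⟹ `m + n√2 = (p + r√2)²`, descent by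
  `3 - 2√2 = (1 - √2)²`).

No named fact, no definition, no `sorry`; nothing about the Hodge conjecture is asserted.
References: [Deligne1982HodgeCycles] §4 p. 30 (1), Cor. 4.2; [Landherr1936HermitianForms]. -/

noncomputable section

set_option linter.dupNamespace false

open Polynomial

namespace Summit.HodgeConjecture.HodgeConjecture.Ring2.WeilCoverageCM

/-! ### §1 Pairs `(a, b) ↔ a + bσ`, `σ² = -6σ - 7` -/

/-- `N(xy) = N(x)N(y)` for `x = a + bσ`, `y = c + dσ`, `xy = (ac - 7bd) + (ad + bc - 6bd)σ`. [folklore] -/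
theorem zs_norm_mul (a b c d : ℤ) :
    (a * c - 7 * b * d) ^ 2 - 6 * (a * c - 7 * b * d) * (a * d + b * c - 6 * b * d)
        + 7 * (a * d + b * c - 6 * b * d) ^ 2
      = (a ^ 2 - 6 * a * b + 7 * b ^ 2) * (c ^ 2 - 6 * c * d + 7 * d ^ 2) := by
  ring

/-- Cancellation in the domain `ℤ[σ]`: `x·y = x·y'`, `N(x) ≠ 0` ⟹ `y = y'` (multiply by `x̄ = (a - 6b) - bσ`). [folklore] -/
theorem zs_mul_left_cancel {a b c d c' d' : ℤ} (hN : a ^ 2 - 6 * a * b + 7 * b ^ 2 ≠ 0)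
    (h1 : a * c - 7 * b * d = a * c' - 7 * b * d')
    (h2 : a * d + b * c - 6 * b * d = a * d' + b * c' - 6 * b * d') : c = c' ∧ d = d' := by
  have e1 : (a ^ 2 - 6 * a * b + 7 * b ^ 2) * (c - c') = 0 := by
    linear_combination (a - 6 * b) * h1 + 7 * b * h2
  have e2 : (a ^ 2 - 6 * a * b + 7 * b ^ 2) * (d - d') = 0 := by
    linear_combination a * h2 - b * h1
  exact ⟨sub_eq_zero.1 ((mul_eq_zero.1 e1).resolve_left hN), sub_eq_zero.1 ((mul_eq_zero.1 e2).resolve_left hN)⟩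

/-- **`σ ∣ a + bσ ⟺ 7 ∣ a`** (`σ·(c + dσ) = -7d + (c - 6d)σ`; the place `(σ)` has residue field `𝔽₇`, `σ ↦ 0`).
[folklore] -/
theorem zs_sigma_dvd_iff (a b : ℤ) : (∃ c d : ℤ, a = -7 * d ∧ b = c - 6 * d) ↔ (7 : ℤ) ∣ a := by
  constructor
  · rintro ⟨c, d, ha, -⟩
    exact ⟨-d, by rw [ha]; ring⟩
  · rintro ⟨k, hk⟩
    exact ⟨b - 6 * k, -k, by rw [hk]; ring, by ring⟩

/-- **`(6 + σ) ∣ a + bσ ⟺ 7 ∣ a + b`** (`(6+σ)(c + dσ) = (6c - 7d) + cσ`; the conjugate place `(3 - √2)` of `(σ)`,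
residue field `𝔽₇`, `σ ↦ 1`). [folklore] -/
theorem zs_p7_dvd_iff (a b : ℤ) : (∃ c d : ℤ, a = 6 * c - 7 * d ∧ b = c) ↔ (7 : ℤ) ∣ a + b := by
  constructor
  · rintro ⟨c, d, ha, hb⟩
    exact ⟨c - d, by rw [ha, hb]; ring⟩
  · rintro ⟨k, hk⟩
    exact ⟨b, b - k, by linear_combination hk, rfl⟩

/-- `7 ∣ N(a,b) ⟹ 7 ∣ a ∨ 7 ∣ a + b` (`N ≡ a(a + b) (mod 7)`): an element of norm divisible by `7` is divisible
by `σ` or by `6 + σ`. [folklore] -/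
theorem zs_seven_dvd_norm {a b : ℤ} (h : (7 : ℤ) ∣ a ^ 2 - 6 * a * b + 7 * b ^ 2) :
    (7 : ℤ) ∣ a ∨ (7 : ℤ) ∣ a + b := by
  have h7 : Prime (7 : ℤ) := by norm_num
  have h' : (7 : ℤ) ∣ a * (a + b) := by
    obtain ⟨k, hk⟩ := h
    exact ⟨k + a * b - b ^ 2, by linear_combination hk⟩
  exact h7.dvd_or_dvd h'

/-- **`(3 + σ) ∣ a + bσ ⟺ 2 ∣ a + b`** (`3 + σ = -√2`, `(3+σ)(c + dσ) = (3c - 7d) + (c - 3d)σ`; the dyadic place,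
residue field `𝔽₂`). [folklore] -/
theorem zs_threeAddSigma_dvd_iff (a b : ℤ) :
    (∃ c d : ℤ, a = 3 * c - 7 * d ∧ b = c - 3 * d) ↔ (2 : ℤ) ∣ a + b := by
  constructor
  · rintro ⟨c, d, ha, hb⟩
    exact ⟨2 * c - 5 * d, by rw [ha, hb]; ring⟩
  · rintro ⟨k, hk⟩
    exact ⟨3 * k - 5 * b, k - 2 * b, by linear_combination hk, by ring⟩

/-- `2 ∣ N(a,b) ⟺ 2 ∣ a + b` (`N ≡ (a + b)² (mod 2)`). [folklore] -/
theorem zs_two_dvd_norm_iff (a b : ℤ) : (2 : ℤ) ∣ a ^ 2 - 6 * a * b + 7 * b ^ 2 ↔ (2 : ℤ) ∣ a + b := by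
  constructor
  · rintro ⟨k, hk⟩
    have h2 : (2 : ℤ) ∣ (a + b) ^ 2 := ⟨k + 4 * a * b - 3 * b ^ 2, by linear_combination hk⟩
    exact Int.prime_two.dvd_of_dvd_pow h2
  · rintro ⟨k, hk⟩
    exact ⟨2 * k ^ 2 - 4 * a * b + 3 * b ^ 2, by
      have ha : a = 2 * k - b := by linear_combination hk
      rw [ha]; ring⟩

/-- **An inert rational prime stays prime**: for a prime `q` with `2` a non-square mod `q` (`q ≡ ±3 (mod 8)`,
inert in `F = ℚ(√2)`), `q ∣ N(a,b) = (a - 3b)² - 2b² ⟹ q ∣ a ∧ q ∣ b`. [folklore] -/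
theorem zs_inert_dvd {q : ℕ} (hq : q.Prime) (h2 : ¬ IsSquare (2 : ZMod q)) {a b : ℤ}
    (h : (q : ℤ) ∣ a ^ 2 - 6 * a * b + 7 * b ^ 2) : (q : ℤ) ∣ a ∧ (q : ℤ) ∣ b := by
  haveI : Fact q.Prime := ⟨hq⟩
  have hz : ((a : ZMod q) - 3 * b) ^ 2 = 2 * (b : ZMod q) ^ 2 := by
    have := (ZMod.intCast_zmod_eq_zero_iff_dvd _ q).2 h
    push_cast at this
    linear_combination this
  have hb : (b : ZMod q) = 0 := by
    by_contra hb
    refine h2 ⟨((a : ZMod q) - 3 * b) / b, ?_⟩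
    field_simp
    linear_combination -hz
  have ha : (a : ZMod q) = 0 := by
    have h3 : ((a : ZMod q) - 3 * b) ^ 2 = 0 := by rw [hz, hb]; ring
    have h0 := pow_eq_zero_iff (n := 2) (by norm_num) |>.1 h3
    rw [hb] at h0
    linear_combination h0
  exact ⟨(ZMod.intCast_zmod_eq_zero_iff_dvd a q).1 ha, (ZMod.intCast_zmod_eq_zero_iff_dvd b q).1 hb⟩

/-! ### §2 A principal degree-one prime `π = u + vσ`, `N(π) = ℓ`, `πγ = t + σ` -/

section DegOne

variable {u v g₀ g₁ t : ℤ} {ℓ : ℕ} (hN : u ^ 2 - 6 * u * v + 7 * v ^ 2 = ℓ)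
  (ht : u * g₀ - 7 * v * g₁ = t) (hγ : v * g₀ + u * g₁ - 6 * v * g₁ = 1)
include hN ht hγ

/-- `u - tv = ℓ·g₁` (`π ≡ 0` at `σ ↦ -t`). [folklore] -/
theorem degOne_u_sub_tv : u - t * v = ℓ * g₁ := by
  rw [← hN, ← ht]
  linear_combination (-u) * hγ

/-- `7v + t(u - 6v) = ℓ·g₀` (the second coordinate relation of `πγ = t + σ`). [folklore] -/
theorem degOne_aux : 7 * v + t * (u - 6 * v) = ℓ * g₀ := by
  rw [← hN, ← ht]
  linear_combination (-7 * v) * hγ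

/-- `t² - 6t + 7 = N(t + σ) = N(π)N(γ) ≡ 0 (mod ℓ)`: `-t` is the image of `σ` at the place `(π)`. [folklore] -/
theorem degOne_root : ((t : ZMod ℓ)) ^ 2 - 6 * t + 7 = 0 := by
  have e0 := zs_norm_mul u v g₀ g₁
  have e : t ^ 2 - 6 * t + 7 = (ℓ : ℤ) * (g₀ ^ 2 - 6 * g₀ * g₁ + 7 * g₁ ^ 2) := by
    rw [← ht, ← hN]
    linear_combination e0 - (7 * (u * g₁ + v * g₀ - 6 * v * g₁) + 7 - 6 * (u * g₀ - 7 * v * g₁)) * hγ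
  have := congrArg (Int.cast : ℤ → ZMod ℓ) e
  push_cast at this
  rw [this, ZMod.natCast_self, zero_mul]

/-- **Divisibility by a degree-one prime**: `π ∣ a + bσ` in `ℤ[σ]` (explicit quotient `c + dσ`) **iff**
`ℓ ∣ a - tb` (`⟸`: `a + bσ = b(t + σ) + ℓk = π(bγ + kπ̄)`). [folklore] -/
theorem degOne_dvd_iff (a b : ℤ) :
    (∃ c d : ℤ, a = u * c - 7 * v * d ∧ b = u * d + v * c - 6 * v * d) ↔ (ℓ : ℤ) ∣ a - t * b := by
  have h1 := degOne_u_sub_tv hN ht hγ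
  have h2 := degOne_aux hN ht hγ
  constructor
  · rintro ⟨c, d, ha, hb⟩
    refine ⟨c * g₁ - d * g₀, ?_⟩
    rw [ha, hb]
    linear_combination c * h1 - d * h2
  · rintro ⟨k, hk⟩
    refine ⟨b * g₀ + k * (u - 6 * v), b * g₁ - k * v, ?_, ?_⟩
    · have ha : a = t * b + ℓ * k := by linear_combination hk
      rw [ha, ← hN, ← ht]
      ring
    · linear_combination (-b) * hγ

/-- **The evaluation `a + bσ ↦ a - tb (mod ℓ)` is multiplicative** (`t² - 6t + 7 ≡ 0`). [folklore] -/
theorem degOne_ev_mul (a b c d : ℤ) :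
    (((a * c - 7 * b * d - t * (a * d + b * c - 6 * b * d) : ℤ) : ZMod ℓ))
      = ((a : ZMod ℓ) - t * b) * ((c : ZMod ℓ) - t * d) := by
  have hr := degOne_root hN ht hγ
  push_cast
  linear_combination (-(b : ZMod ℓ) * d) * hr

/-- **Euclid's lemma for a degree-one prime** (`ℓ` prime): `π ∣ xy ⟹ π ∣ x ∨ π ∣ y`, `x = a + bσ`, `y = c + dσ`,
`xy = (ac - 7bd) + (ad + bc - 6bd)σ`. [folklore] -/
theorem degOne_euclid (hℓ : ℓ.Prime) (a b c d : ℤ)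
    (h : ∃ e f : ℤ, a * c - 7 * b * d = u * e - 7 * v * f ∧
      a * d + b * c - 6 * b * d = u * f + v * e - 6 * v * f) :
    (∃ e f : ℤ, a = u * e - 7 * v * f ∧ b = u * f + v * e - 6 * v * f) ∨
      (∃ e f : ℤ, c = u * e - 7 * v * f ∧ d = u * f + v * e - 6 * v * f) := by
  haveI : Fact ℓ.Prime := ⟨hℓ⟩
  rw [degOne_dvd_iff hN ht hγ, degOne_dvd_iff hN ht hγ, ← ZMod.intCast_zmod_eq_zero_iff_dvd,
    ← ZMod.intCast_zmod_eq_zero_iff_dvd]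
  rw [degOne_dvd_iff hN ht hγ, ← ZMod.intCast_zmod_eq_zero_iff_dvd, degOne_ev_mul hN ht hγ] at h
  push_cast
  exact mul_eq_zero.1 h

/-- `π ∣ x² ⟹ π ∣ x` (`x = a + bσ`, `x² = (a² - 7b²) + (2ab - 6b²)σ`). [folklore] -/
theorem degOne_dvd_of_dvd_sq (hℓ : ℓ.Prime) (a b : ℤ)
    (h : ∃ e f : ℤ, a ^ 2 - 7 * b ^ 2 = u * e - 7 * v * f ∧ 2 * a * b - 6 * b ^ 2 = u * f + v * e - 6 * v * f) :
    ∃ e f : ℤ, a = u * e - 7 * v * f ∧ b = u * f + v * e - 6 * v * f := by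
  obtain ⟨e, f, h1, h2⟩ := h
  rcases degOne_euclid hN ht hγ hℓ a b a b ⟨e, f, by linear_combination h1, by linear_combination h2⟩ with h | h
  · exact h
  · exact h

/-- `ℓ ∣ N(x) ⟹ π ∣ x ∨ π̄ ∣ x`, i.e. `π ∣ x` or `π ∣ x̄` (`x̄ = (a - 6b) - bσ`; `N(x) = x·x̄`). [folklore] -/
theorem degOne_dvd_or_dvd_conj_of_dvd_norm (hℓ : ℓ.Prime) (a b : ℤ)
    (h : (ℓ : ℤ) ∣ a ^ 2 - 6 * a * b + 7 * b ^ 2) :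
    (∃ e f : ℤ, a = u * e - 7 * v * f ∧ b = u * f + v * e - 6 * v * f) ∨
      (∃ e f : ℤ, a - 6 * b = u * e - 7 * v * f ∧ -b = u * f + v * e - 6 * v * f) := by
  refine degOne_euclid hN ht hγ hℓ a b (a - 6 * b) (-b) ?_
  -- `x·x̄ = N(x) = ℓ·k = π·(k·π̄)`
  obtain ⟨k, hk⟩ := h
  refine ⟨k * (u - 6 * v), -(k * v), ?_, ?_⟩
  · rw [← hN] at hk
    linear_combination hk
  · ring

end DegOne

/-! ### §3 Total positivity: `0 < a - 3b ∧ 0 < N(a,b)` (`N = (a - 3b)² - 2b²`: both real embeddings positive) -/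

/-- **Products of totally positive elements are totally positive.** [folklore] -/
theorem totPos_mul {a b c d : ℤ} (ha : 0 < a - 3 * b) (hNa : 0 < a ^ 2 - 6 * a * b + 7 * b ^ 2)
    (hc : 0 < c - 3 * d) (hNc : 0 < c ^ 2 - 6 * c * d + 7 * d ^ 2) :
    0 < (a * c - 7 * b * d) - 3 * (a * d + b * c - 6 * b * d) ∧
      0 < (a * c - 7 * b * d) ^ 2 - 6 * (a * c - 7 * b * d) * (a * d + b * c - 6 * b * d)
        + 7 * (a * d + b * c - 6 * b * d) ^ 2 := by
  refine ⟨?_, by rw [zs_norm_mul]; exact mul_pos hNa hNc⟩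
  have hb2 : 2 * b ^ 2 < (a - 3 * b) ^ 2 := by nlinarith
  have hd2 : 2 * d ^ 2 < (c - 3 * d) ^ 2 := by nlinarith
  have h1 : (2 * b * d) ^ 2 < ((a - 3 * b) * (c - 3 * d)) ^ 2 := by
    have := mul_lt_mul'' hb2 hd2 (by positivity) (by positivity)
    nlinarith
  have h2 := abs_lt_of_sq_lt_sq h1 (le_of_lt (mul_pos ha hc))
  have h3 := (abs_lt.1 h2).1
  nlinarith

/-- `0 < N(a,b) ⟹ a - 3b ≠ 0` (else `N = -2b² ≤ 0`). [folklore] -/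
theorem sub_three_mul_ne_zero_of_norm_pos {a b : ℤ} (hN : 0 < a ^ 2 - 6 * a * b + 7 * b ^ 2) : a - 3 * b ≠ 0 := by
  intro h
  have ha : a = 3 * b := by linear_combination h
  rw [ha] at hN
  nlinarith [sq_nonneg b]

/-- **Cancellation of total positivity**: `x` and `xy` totally positive ⟹ `y` totally positive. [folklore] -/
theorem totPos_cancel {a b c d : ℤ} (ha : 0 < a - 3 * b) (hNa : 0 < a ^ 2 - 6 * a * b + 7 * b ^ 2)
    (h1 : 0 < (a * c - 7 * b * d) - 3 * (a * d + b * c - 6 * b * d))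
    (h2 : 0 < (a * c - 7 * b * d) ^ 2 - 6 * (a * c - 7 * b * d) * (a * d + b * c - 6 * b * d)
        + 7 * (a * d + b * c - 6 * b * d) ^ 2) :
    0 < c - 3 * d ∧ 0 < c ^ 2 - 6 * c * d + 7 * d ^ 2 := by
  rw [zs_norm_mul] at h2
  have hNc : 0 < c ^ 2 - 6 * c * d + 7 * d ^ 2 := pos_of_mul_pos_right h2 hNa.le
  refine ⟨?_, hNc⟩
  rcases lt_trichotomy 0 (c - 3 * d) with h | h | h
  · exact h
  · exact absurd h.symm (sub_three_mul_ne_zero_of_norm_pos hNc)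
  · exfalso
    have hc' : 0 < -c - 3 * -d := by linarith
    have hNc' : 0 < (-c) ^ 2 - 6 * -c * -d + 7 * (-d) ^ 2 := by linarith
    have := (totPos_mul ha hNa hc' hNc').1
    linarith

/-- The three special elements are totally positive: `-σ = 3 + √2` (`(0,-1)`), `-1 - σ = 2 + √2` (`(-1,-1)`),
`6 + σ = 3 - √2` (`(6,1)`); and `(3+σ)² = 2`, `(-1-σ) = (3+σ)(-2-σ)` with `-2-σ = 1 + √2` a unit. [folklore] -/
theorem totPos_specials :
    (0 < (0 : ℤ) - 3 * (-1) ∧ 0 < (0 : ℤ) ^ 2 - 6 * 0 * (-1) + 7 * (-1) ^ 2) ∧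
    (0 < (-1 : ℤ) - 3 * (-1) ∧ 0 < (-1 : ℤ) ^ 2 - 6 * (-1) * (-1) + 7 * (-1) ^ 2) ∧
    (0 < (6 : ℤ) - 3 * 1 ∧ 0 < (6 : ℤ) ^ 2 - 6 * 6 * 1 + 7 * 1 ^ 2) := by
  norm_num

/-! ### §4 Pell: a totally positive unit of `ℤ[√2]` is a square -/

/-- **Pell descent**: `m² - 2n² = 1`, `0 < m` ⟹ `m + n√2 = (p + r√2)²`, i.e. `m = p² + 2r²`, `n = 2pr`
(multiply by `3 ∓ 2√2 = (1 ∓ √2)²` until `n = 0`). [folklore] -/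
theorem pell_sq : ∀ (k : ℕ) (m n : ℤ), n.natAbs ≤ k → 0 < m → m ^ 2 - 2 * n ^ 2 = 1 →
    ∃ p r : ℤ, m = p ^ 2 + 2 * r ^ 2 ∧ n = 2 * p * r := by
  intro k
  induction k using Nat.strong_induction_on with
  | _ k ih =>
    intro m n hk hm h
    by_cases hn0 : n = 0
    · subst hn0
      have hm1 : m = 1 := by nlinarith
      exact ⟨1, 0, by rw [hm1]; norm_num, by norm_num⟩
    -- `|n| ≥ 2`
    have hn1 : n ≠ 1 := by
      rintro rfl
      rcases (show m = 1 ∨ 2 ≤ m by omega) with rfl | h2 <;> nlinarith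
    have hn1' : n ≠ -1 := by
      rintro rfl
      rcases (show m = 1 ∨ 2 ≤ m by omega) with rfl | h2 <;> nlinarith
    have hmn : n ^ 2 < m ^ 2 := by nlinarith
    rcases lt_or_gt_of_ne hn0 with hneg | hpos
    · -- `n < 0`: multiply by `3 + 2√2`: `(3m + 4n) + (3n + 2m)√2`, `n < 3n + 2m ≤ 0`
      have hn2 : n ≤ -2 := by omega
      have h9 : 4 * m ^ 2 ≤ 9 * n ^ 2 := by nlinarith
      have hmn' : -n < m := by nlinarith
      have hle : 3 * n + 2 * m ≤ 0 := by nlinarith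
      have hlt : n < 3 * n + 2 * m := by linarith
      have hm' : 0 < 3 * m + 4 * n := by nlinarith
      have hk' : (3 * n + 2 * m).natAbs < k := by
        have : (3 * n + 2 * m).natAbs < n.natAbs := by omega
        omega
      obtain ⟨p, r, hp, hr⟩ := ih _ hk' (3 * m + 4 * n) (3 * n + 2 * m) le_rfl hm' (by linear_combination h)
      -- `m + n√2 = ((3m+4n) + (3n+2m)√2)(3 - 2√2) = (p + r√2)²(1 - √2)² = ((p - 2r) + (r - p)√2)²`
      refine ⟨p - 2 * r, r - p, ?_, ?_⟩
      · have : m = 3 * (3 * m + 4 * n) - 4 * (3 * n + 2 * m) := by ring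
        rw [this, hp, hr]; ring
      · have : n = 3 * (3 * n + 2 * m) - 2 * (3 * m + 4 * n) := by ring
        rw [this, hp, hr]; ring
    · -- `n > 0`: multiply by `3 - 2√2`: `(3m - 4n) + (3n - 2m)√2`, `0 ≤ 3n - 2m < n`
      have hn2 : 2 ≤ n := by omega
      have h9 : 4 * m ^ 2 ≤ 9 * n ^ 2 := by nlinarith
      have hmn' : n < m := by nlinarith
      have hle : 0 ≤ 3 * n - 2 * m := by nlinarith
      have hlt : 3 * n - 2 * m < n := by linarith
      have hm' : 0 < 3 * m - 4 * n := by nlinarith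
      have hk' : (3 * n - 2 * m).natAbs < k := by
        have : (3 * n - 2 * m).natAbs < n.natAbs := by omega
        omega
      obtain ⟨p, r, hp, hr⟩ := ih _ hk' (3 * m - 4 * n) (3 * n - 2 * m) le_rfl hm' (by linear_combination h)
      -- `m + n√2 = ((3m-4n) + (3n-2m)√2)(3 + 2√2) = ((p + 2r) + (p + r)√2)²`
      refine ⟨p + 2 * r, p + r, ?_, ?_⟩
      · have : m = 3 * (3 * m - 4 * n) + 4 * (3 * n - 2 * m) := by ring
        rw [this, hp, hr]; ring
      · have : n = 3 * (3 * n - 2 * m) + 2 * (3 * m - 4 * n) := by ring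
        rw [this, hp, hr]; ring

/-- **A totally positive unit of `ℤ[σ]` is a square**, in `σ`-coordinates: `0 < a - 3b`, `N(a,b) = 1` ⟹
`a + bσ = (w₀ + w₁σ)²`, i.e. `a = w₀² - 7w₁²`, `b = 2w₀w₁ - 6w₁²`, with `N(w₀,w₁)² = 1`
(`a + bσ = (a - 3b) - b√2`). [folklore] -/
theorem totPos_unit_sq {a b : ℤ} (ha : 0 < a - 3 * b) (hN : a ^ 2 - 6 * a * b + 7 * b ^ 2 = 1) :
    ∃ w₀ w₁ : ℤ, a = w₀ ^ 2 - 7 * w₁ ^ 2 ∧ b = 2 * w₀ * w₁ - 6 * w₁ ^ 2 ∧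
      (w₀ ^ 2 - 6 * w₀ * w₁ + 7 * w₁ ^ 2) ^ 2 = 1 := by
  obtain ⟨p, r, hp, hr⟩ := pell_sq (-b).natAbs (a - 3 * b) (-b) le_rfl ha (by linear_combination hN)
  -- `p + r√2 = p + r(-σ - 3) = (p - 3r) - rσ`
  refine ⟨p - 3 * r, -r, ?_, ?_, ?_⟩
  · have : a = (a - 3 * b) + 3 * -(-b) := by ring
    rw [this, hp, hr]; ring
  · have : b = -(-b) := by ring
    rw [this, hr]; ring
  · have e : ((p - 3 * r) ^ 2 - 6 * (p - 3 * r) * (-r) + 7 * (-r) ^ 2) ^ 2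
        = (p ^ 2 + 2 * r ^ 2) ^ 2 - 2 * (2 * p * r) ^ 2 := by ring
    rw [e, ← hp, ← hr]
    linear_combination hN

end Summit.HodgeConjecture.HodgeConjecture.Ring2.WeilCoverageCM

end
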